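import Summits.KontsevichZagierPeriods.KontsevichZagierPeriods.Theorems.HermiteRigidityEllipticMomentKernelStubSigmaRep
import Summits.KontsevichZagierPeriods.KontsevichZagierPeriods.Theorems.HermiteRigidityEllipticMomentKernelStubColumnMove
import Summits.KontsevichZagierPeriods.KontsevichZagierPeriods.Theorems.HermiteRigidityEllipticMomentKernelStubHermiteExactForm
import Summits.KontsevichZagierPeriods.KontsevichZagierPeriods.Theorems.HermiteRigidityEllipticMomentKernelStubPolynomialPart
import Summits.KontsevichZagierPeriods.KontsevichZagierPeriods.Theorems.HermiteRigidityEllipticMomentKernelStubNumeratorValue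
import Summits.KontsevichZagierPeriods.KontsevichZagierPeriods.Theorems.HermiteRigidityEllipticMomentKernelStubMergeToCarrier

/-!
# `EllipticMomentKernel` (stmt-KontsevichZagierPeriods-10631), line `merge-first-single-hermite`

Route `HermiteRigidity`, crux decl
`Summit.KontsevichZagierPeriods.KontsevichZagierPeriods.Theses.HermiteRigidity.EllipticMomentKernel`:
for every rational cubic `f = 4x³ − q₂x − q₃` with `disc > 0` (bounded oval `σ = (e₃,e₂)`), IF
`1, J₀ = ∫_σ dx/√f, J₁ = ∫_σ x dx/√f` are linearly independent over the real algebraic numbers, THEN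
every `ℤ`-combination of the generators `[D, x^a y^b]` (`D` = region under `√f` over `σ`) and
`[σ, x^m/√f]` of value `0` lies in `KZ.relations`.

## The line (merge first, reduce once; = one-interval-linearisation after the panel merge)

Every element `c` of the sector is congruent modulo `KZ.relations` to ONE representation on `σ`
with integrand `A(x) + B(x)/√f(x)`, `A, B ∈ ℚ[X]` (the CARRIER): generators of the second kind are
already of this shape (`A = 0`, `B = X^m`); a moment `[D, x^a y^b]` becomes `[σ, x^a (√f)^{b+1}/(b+1)]`
by ONE Newton–Leibniz move along `y` (`stub_columnMove`), which is `A = x^a f^{(b+1)/2}/(b+1)`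
(`b` odd) or `B = x^a f^{b/2+1}/(b+1)` (`b` even); sums and negatives merge by rule 1b on the common
domain `σ` (`stub_mergeToCarrier`, representations supplied by `stub_sigmaRep`). Then, ONCE:
Hermite `B = α + βX + D(P)` with `D(P) = P′f + Pf′/2` (`hermiteDecomposition`, pure algebra, proved
here); the value of the carrier is `∫_σ A + αJ₀ + βJ₁` (`stub_numeratorValue`, the exact part
`∫_σ D(P)/√f` vanishing because `[σ, D(P)/√f] ∈ relations` — support item `HermiteExactFormVanishes`
= `stub_hermiteExactForm` — and relations are sound); `∫_σ A ∈ ℚ(e₂,e₃)` is real algebraic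
(`stub_polynomialPart`), so `eval c = 0` and the INLINED rigidity give `α = β = 0`, `∫_σ A = 0`:
the merged numerator is EXACT, `B = D(P)`, and `[σ, A + D(P)/√f] = [σ, A] + [σ, D(P)/√f]` (rule 1b)
with `[σ, D(P)/√f] ∈ relations` (3412) and `[σ, A] ∈ relations` (`stub_polynomialPart`: one
Newton–Leibniz move onto `[pt, 0]`). Composition `EllipticMomentKernel_of` below; the six `stub_*` are the LANDED stub files
`Theorems/HermiteRigidityEllipticMomentKernelStub*.lean` (imported).

Vocabulary (`cubic`, `disc`, `oval` = σ, `underGraph` = D, `gens = gens₂ ∪ gens₁` = S, `J0`, `J1`,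
`Rigid`, `KernelClaim`, `ellipticMomentKernel_iff : EllipticMomentKernel ↔ ∀ q₂ q₃, 0 < disc → Rigid →
KernelClaim` by `Iff.rfl`) is the landed `Theorems/EllipticMomentKernel/Negative/LoadBearing.lean`;
roots / `σ = (e₃,e₂)` / semialgebraicity / `x^m/√f ∈ L¹(σ)` are `Negative/Roots.lean`,
`Negative/GeneralCurve.lean` (standing disprover, all sorry-free, `--supports` this item).

Disproof honoured (Cruxes/EllipticMomentKernel/Disproof.lean v4): no `_false_without_` theorem exists;
§3/§4 (every derivation instantiates `newtonLeibnizRel` AND mixes (1b) with (3)) is exactly this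
line's shape; §5 `hermiteElem_mem_relations` is the model instance of `stub_hermiteExactForm`.
-/

noncomputable section

open MeasureTheory Set
open scoped Polynomial

namespace Summit.KontsevichZagierPeriods.HermiteRigidity.EllipticMomentKernel

open Literature.NumberTheory.Transcendental
open Literature.NumberTheory.Transcendental.KZ
open Summit.KontsevichZagierPeriods.HermiteRigidity.EllipticMomentKernelNegative
open Summit.KontsevichZagierPeriods.KontsevichZagierPeriods.Theses.HermiteRigidity
  (EllipticMomentKernel HermiteExactFormVanishes)

/-! ## §0 Hermite's decomposition `ℚ[X] = ℚ ⊕ ℚ·X + D(ℚ[X])` (pure algebra, PROVED) -/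

/-- **Hermite decomposition.** For the operator `D(P) = P′·f + P·f′/2` of the cubic
`f = 4X³ − q₂X − q₃` (so that `d(P√f) = D(P) dx/√f`), every `Q ∈ ℚ[X]` is `α + βX + D(P)` with
`α, β ∈ ℚ`, `P ∈ ℚ[X]`: `D(1) = 6X² − q₂/2` and
`D(X^{d+1}) = (4d+10)X^{d+3} − (d+3/2)q₂X^{d+1} − (d+1)q₃X^d` have non-vanishing pivots, so a strong
induction on the exponent peels the top monomial; no hypothesis on `q₂, q₃`.
[cite: BostanLairezSalvy2013, §1] [cite: Lawden1989, §3.3 (3.3.33)] -/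
theorem hermiteDecomposition (q₂ q₃ : ℚ) (Q : ℚ[X]) :
    ∃ (α β : ℚ) (P : ℚ[X]), Q = Polynomial.C α + Polynomial.C β * Polynomial.X +
      (Polynomial.derivative P * (4 * Polynomial.X ^ 3 - Polynomial.C q₂ * Polynomial.X - Polynomial.C q₃) +
        P * (Polynomial.C (1 / 2 : ℚ) * (12 * Polynomial.X ^ 2 - Polynomial.C q₂))) := by
  -- the Hermite operator as a `ℚ`-linear map (local, no new definition)
  let D : ℚ[X] →ₗ[ℚ] ℚ[X] :=
    { toFun := fun P => Polynomial.derivative P *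
          (4 * Polynomial.X ^ 3 - Polynomial.C q₂ * Polynomial.X - Polynomial.C q₃) +
        P * (Polynomial.C (1 / 2 : ℚ) * (12 * Polynomial.X ^ 2 - Polynomial.C q₂))
      map_add' := fun P Q => by
        simp only [Polynomial.derivative_add]; ring
      map_smul' := fun c P => by
        simp only [Polynomial.derivative_smul, smul_mul_assoc, smul_add, RingHom.id_apply] }
  have hDapply : ∀ P, D P = Polynomial.derivative P *
        (4 * Polynomial.X ^ 3 - Polynomial.C q₂ * Polynomial.X - Polynomial.C q₃) +
      P * (Polynomial.C (1 / 2 : ℚ) * (12 * Polynomial.X ^ 2 - Polynomial.C q₂)) := fun P => rfl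
  set M : Submodule ℚ ℚ[X] :=
    Submodule.span ℚ {(1 : ℚ[X]), Polynomial.X} ⊔ LinearMap.range D with hM
  have h1 : (1 : ℚ[X]) ∈ M := Submodule.mem_sup_left (Submodule.subset_span (by simp))
  have hX : (Polynomial.X : ℚ[X]) ∈ M := Submodule.mem_sup_left (Submodule.subset_span (by simp))
  have hD : ∀ P, D P ∈ M := fun P => Submodule.mem_sup_right ⟨P, rfl⟩
  -- `X² = (1/6)·(D(1) + q₂/2)`
  have hX2 : (Polynomial.X : ℚ[X]) ^ 2 = (1 / 6 : ℚ) • (D 1 + (q₂ / 2 : ℚ) • (1 : ℚ[X])) := by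
    rw [hDapply]
    apply Polynomial.funext
    intro x
    simp
    ring
  -- `X^{d+3} = (4d+10)⁻¹·(D(X^{d+1}) + (d+3/2)q₂·X^{d+1} + (d+1)q₃·X^d)`
  have hX3 : ∀ d : ℕ, (Polynomial.X : ℚ[X]) ^ (d + 3) = (1 / (4 * (d : ℚ) + 10)) •
      (D (Polynomial.X ^ (d + 1)) + (((d : ℚ) + 3 / 2) * q₂) • Polynomial.X ^ (d + 1) +
        (((d : ℚ) + 1) * q₃) • Polynomial.X ^ d) := by
    intro d
    have hd : (4 * (d : ℚ) + 10) ≠ 0 := by positivity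
    rw [hDapply]
    apply Polynomial.funext
    intro x
    simp
    field_simp
    ring
  have hpow : ∀ m : ℕ, (Polynomial.X : ℚ[X]) ^ m ∈ M := by
    intro m
    induction m using Nat.strong_induction_on with
    | _ m ih =>
      match m with
      | 0 => simpa using h1
      | 1 => simpa using hX
      | 2 =>
        rw [hX2]
        exact M.smul_mem _ (M.add_mem (hD 1) (M.smul_mem _ h1))
      | d + 3 =>
        rw [hX3 d]
        exact M.smul_mem _ (M.add_mem (M.add_mem (hD _) (M.smul_mem _ (ih (d + 1) (by omega))))
          (M.smul_mem _ (ih d (by omega))))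
  have hall : Q ∈ M := by
    induction Q using Polynomial.induction_on' with
    | add p q hp hq => exact M.add_mem hp hq
    | monomial n a =>
      rw [← Polynomial.C_mul_X_pow_eq_monomial, ← Polynomial.smul_eq_C_mul]
      exact M.smul_mem a (hpow n)
  rw [hM, Submodule.mem_sup] at hall
  obtain ⟨y, hy, z, hz, hyz⟩ := hall
  rw [Submodule.mem_span_pair] at hy
  obtain ⟨α, β, rfl⟩ := hy
  obtain ⟨P, rfl⟩ := hz
  refine ⟨α, β, P, ?_⟩
  rw [← hyz, hDapply, Polynomial.smul_eq_C_mul, Polynomial.smul_eq_C_mul, mul_one]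

/-! ## §1 The six stubs (LANDED, imported)

* `stub_sigmaRep` (…StubSigmaRep.lean): the carriers `[σ, A + B/√f]` exist as `IntegralRep 1`.
* `stub_columnMove` (…StubColumnMove.lean): `[D, x^a y^b] ≡ [σ, x^a (√f)^{b+1}/(b+1)]`, ONE rule-3
  move along `y` over the open base `σ` plus two null graphs.
* `stub_hermiteExactForm : HermiteExactFormVanishes` (…StubHermiteExactForm.lean): support item 3412
  verbatim — `[σ, (P′f + Pf′/2)/√f] ∈ relations`, ONE rule-3 move over `ℝ⁰` on the closed band
  `[e₃, e₂]` with primitive `P√f`.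
* `stub_polynomialPart` (…StubPolynomialPart.lean): `∫_σ A` is real algebraic, and `[σ, A] ∈ relations`
  when it vanishes.
* `stub_numeratorValue` (…StubNumeratorValue.lean): value of a carrier after Hermite.
* `stub_mergeToCarrier` (…StubMergeToCarrier.lean): closure induction (rule 1b only). -/

/-! ## §2 Glue (PROVED): parity bookkeeping of the column move, soundness, the end game -/

/-- `√x ^ (2k) = x ^ k` for `x ≥ 0`. [folklore] -/
theorem sqrt_pow_two_mul {x : ℝ} (hx : 0 ≤ x) (k : ℕ) : Real.sqrt x ^ (2 * k) = x ^ k := by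
  rw [pow_mul, Real.sq_sqrt hx]

/-- `√x ^ (2k+1) = x ^ (k+1) / √x` for `x > 0`. [folklore] -/
theorem sqrt_pow_two_mul_add_one {x : ℝ} (hx : 0 < x) (k : ℕ) :
    Real.sqrt x ^ (2 * k + 1) = x ^ (k + 1) / Real.sqrt x := by
  have hs : 0 < Real.sqrt x := Real.sqrt_pos.2 hx
  rw [pow_succ, sqrt_pow_two_mul hx.le, eq_div_iff hs.ne', mul_assoc, Real.mul_self_sqrt hx.le,
    pow_succ]

/-- Evaluation of the cubic `4X³ − q₂X − q₃ ∈ ℚ[X]` at a real point is `cubic q₂ q₃`. [folklore] -/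
theorem aeval_cubic (q₂ q₃ : ℚ) (x : ℝ) :
    (Polynomial.aeval x (4 * Polynomial.X ^ 3 - Polynomial.C q₂ * Polynomial.X - Polynomial.C q₃ : ℚ[X]) : ℝ)
      = cubic q₂ q₃ x := by
  simp [cubic, map_ofNat]

/-- **The column move in carrier form** (glue over `stub_sigmaRep` + `stub_columnMove`): every
2-dimensional generator `[D, x^a y^b]` is congruent to a carrier, with `(A, B) = (x^a f^{k+1}/(b+1), 0)`
if `b = 2k+1` and `(A, B) = (0, x^a f^{k+1}/(b+1))` if `b = 2k` (on `σ`, where `f > 0`,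
`(√f)^{2k+2} = f^{k+1}` and `(√f)^{2k+1} = f^{k+1}/√f`). [cite: KontsevichZagier2001, §1.2] -/
theorem gens₂_carrier (q₂ q₃ : ℚ) (hΔ : 0 < disc q₂ q₃) :
    ∀ x ∈ gens₂ q₂ q₃, ∃ (A B : ℚ[X]) (s : IntegralRep 1), s.domain = oval q₂ q₃ ∧
      EqOn s.integrand (fun p => (Polynomial.aeval (p 0) A : ℝ) +
        (Polynomial.aeval (p 0) B : ℝ) / Real.sqrt (cubic q₂ q₃ (p 0))) (oval q₂ q₃) ∧
      x - KZ.of s ∈ KZ.relations := by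
  rintro x ⟨r, a, b, hr, hri, rfl⟩
  -- the reduced numerator `x^a f^{k+1}/(b+1)`
  set fQ : ℚ[X] := 4 * Polynomial.X ^ 3 - Polynomial.C q₂ * Polynomial.X - Polynomial.C q₃ with hfQ
  rcases Nat.even_or_odd b with ⟨k, hk⟩ | ⟨k, hk⟩
  · -- `b = k + k` even: `(√f)^{b+1} = f^k √f = f^{k+1}/√f`, an elliptic carrier
    set B : ℚ[X] := Polynomial.C (1 / ((b : ℚ) + 1)) * Polynomial.X ^ a * fQ ^ (k + 1) with hB
    obtain ⟨s, hs, hsi⟩ := stub_sigmaRep q₂ q₃ hΔ 0 B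
    refine ⟨0, B, s, hs, fun p _ => by rw [hsi], ?_⟩
    refine stub_columnMove q₂ q₃ hΔ a b r hr hri s hs fun p hp => ?_
    have hf : 0 < cubic q₂ q₃ (p 0) := hp.1
    have hsq : 0 < Real.sqrt (cubic q₂ q₃ (p 0)) := Real.sqrt_pos.2 hf
    have hb1 : ((b : ℝ) + 1) ≠ 0 := by positivity
    rw [hsi]
    simp only [map_zero, zero_add, hB, map_mul, Polynomial.aeval_C, map_pow, Polynomial.aeval_X,
      eq_ratCast, hfQ, aeval_cubic]
    rw [show b + 1 = 2 * k + 1 by omega, sqrt_pow_two_mul_add_one hf k]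
    push_cast
    field_simp
  · -- `b = 2k + 1` odd: `(√f)^{b+1} = f^{k+1}`, a polynomial carrier
    set A : ℚ[X] := Polynomial.C (1 / ((b : ℚ) + 1)) * Polynomial.X ^ a * fQ ^ (k + 1) with hA
    obtain ⟨s, hs, hsi⟩ := stub_sigmaRep q₂ q₃ hΔ A 0
    refine ⟨A, 0, s, hs, fun p _ => by rw [hsi], ?_⟩
    refine stub_columnMove q₂ q₃ hΔ a b r hr hri s hs fun p hp => ?_
    have hf : 0 < cubic q₂ q₃ (p 0) := hp.1
    have hb1 : ((b : ℝ) + 1) ≠ 0 := by positivity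
    rw [hsi]
    simp only [map_zero, zero_div, add_zero, hA, map_mul, Polynomial.aeval_C, map_pow,
      Polynomial.aeval_X, eq_ratCast, hfQ, aeval_cubic]
    rw [show b + 1 = 2 * (k + 1) by omega, sqrt_pow_two_mul hf.le (k + 1)]
    push_cast
    field_simp

/-- Soundness, pointwise: a relation has value `0`. [cite: KontsevichZagier2001, §1.2] -/
theorem eval_eq_zero_of_mem_relations {c : FormalRep} (hc : c ∈ KZ.relations) : KZ.eval c = 0 :=
  (AddMonoidHom.mem_ker).1 (relations_le_ker_eval_holds hc)

/-- **The exact part has value zero** (glue over `stub_hermiteExactForm` + `stub_sigmaRep` +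
soundness): `∫_σ D(P)/√f = 0`, because `[σ, D(P)/√f]` exists and is a relation.
[cite: KontsevichZagier2001, §1.2] -/
theorem integral_hermiteOp_div_sqrt_eq_zero (q₂ q₃ : ℚ) (hΔ : 0 < disc q₂ q₃) (P : ℚ[X]) :
    (∫ p in oval q₂ q₃, (Polynomial.aeval (p 0)
        (Polynomial.derivative P * (4 * Polynomial.X ^ 3 - Polynomial.C q₂ * Polynomial.X - Polynomial.C q₃) +
          P * (Polynomial.C (1 / 2 : ℚ) * (12 * Polynomial.X ^ 2 - Polynomial.C q₂))) : ℝ) /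
        Real.sqrt (cubic q₂ q₃ (p 0))) = 0 := by
  set E : ℚ[X] := Polynomial.derivative P *
      (4 * Polynomial.X ^ 3 - Polynomial.C q₂ * Polynomial.X - Polynomial.C q₃) +
    P * (Polynomial.C (1 / 2 : ℚ) * (12 * Polynomial.X ^ 2 - Polynomial.C q₂)) with hE
  obtain ⟨t, ht, hti⟩ := stub_sigmaRep q₂ q₃ hΔ 0 E
  -- `t = [σ, D(P)/√f]` is the representation of the support item `HermiteExactFormVanishes`
  have hmem : KZ.of t ∈ KZ.relations := by
    refine stub_hermiteExactForm q₂ q₃ hΔ P t ht fun p _ => ?_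
    rw [hti]
    simp only [map_zero, zero_add, hE, map_add, map_mul, Polynomial.aeval_C, eq_ratCast, map_sub,
      map_pow, Polynomial.aeval_X, map_ofNat, cubic]
    push_cast
    ring
  have hval : t.value = 0 := by rw [← eval_of]; exact eval_eq_zero_of_mem_relations hmem
  have hmeas : MeasurableSet (oval q₂ q₃) := ht ▸ IntegralRep.measurableSet_domain_holds t
  calc (∫ p in oval q₂ q₃, (Polynomial.aeval (p 0) E : ℝ) / Real.sqrt (cubic q₂ q₃ (p 0)))
      = ∫ p in oval q₂ q₃, t.integrand p := by
        refine setIntegral_congr_fun hmeas fun p _ => ?_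
        rw [hti]
        simp
    _ = t.value := by rw [IntegralRep.value, ht]
    _ = 0 := hval

/-- The inlined rigidity in the form the end game consumes: `A + αJ₀ + βJ₁ = 0` with `A` real
algebraic and `α, β ∈ ℚ` forces `A = 0`, `α = β = 0`. [cite: Masser1975, Thm II/III] -/
theorem rigid_coordinates {q₂ q₃ : ℚ} (hR : Rigid q₂ q₃) {A : ℝ} {α β : ℚ} (hA : IsAlgebraic ℚ A)
    (h : A + (α : ℝ) * J0 q₂ q₃ + (β : ℝ) * J1 q₂ q₃ = 0) : A = 0 ∧ α = 0 ∧ β = 0 := by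
  obtain ⟨h₁, h₂, h₃⟩ := hR A α β hA (isAlgebraic_algebraMap (R := ℚ) (A := ℝ) α)
    (isAlgebraic_algebraMap (R := ℚ) (A := ℝ) β) h
  exact ⟨h₁, by exact_mod_cast h₂, by exact_mod_cast h₃⟩

/-- **The crux `EllipticMomentKernel`, composed from the six stubs** (line
`merge-first-single-hermite`): merge `c` to a carrier `[σ, A + B/√f]`; Hermite `B = α + βX + D(P)`;
value `∫_σ A + αJ₀ + βJ₁ = eval c = 0`; rigidity ⇒ `α = β = 0 = ∫_σ A`; so the carrier is
`[σ, A] + [σ, D(P)/√f]` (rule 1b), both relations. [cite: KontsevichZagier2001, §1.2]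
[cite: Masser1975, Thm II/III] [cite: BostanLairezSalvy2013, §1] -/
theorem EllipticMomentKernel_of : EllipticMomentKernel := by
  rw [ellipticMomentKernel_iff]
  intro q₂ q₃ hΔ hR c hc h0
  -- MERGE: `c ≡ [σ, A + B/√f]`
  obtain ⟨A, B, s, hs, hsi, hcs⟩ :=
    stub_mergeToCarrier q₂ q₃ hΔ (stub_sigmaRep q₂ q₃ hΔ) (gens₂_carrier q₂ q₃ hΔ) c hc
  -- HERMITE: `B = α + βX + D(P)`
  obtain ⟨α, β, P, hB⟩ := hermiteDecomposition q₂ q₃ B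
  set E : ℚ[X] := Polynomial.derivative P *
      (4 * Polynomial.X ^ 3 - Polynomial.C q₂ * Polynomial.X - Polynomial.C q₃) +
    P * (Polynomial.C (1 / 2 : ℚ) * (12 * Polynomial.X ^ 2 - Polynomial.C q₂)) with hE
  have hE0 := integral_hermiteOp_div_sqrt_eq_zero q₂ q₃ hΔ P
  rw [← hE] at hE0
  -- VALUE: `value s = ∫_σ A + αJ₀ + βJ₁ = eval c = 0`
  have hval := stub_numeratorValue q₂ q₃ hΔ A E α β hE0 s hs (by rw [← hB]; exact hsi)
  have hs0 : s.value = 0 := by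
    have h1 : KZ.eval (c - KZ.of s) = 0 := eval_eq_zero_of_mem_relations hcs
    rw [map_sub, h0, eval_of, zero_sub, neg_eq_zero] at h1
    exact h1
  obtain ⟨hAalg, hA0⟩ := stub_polynomialPart q₂ q₃ hΔ A
  -- RIGIDITY: the merged numerator is exact
  obtain ⟨hIA, rfl, rfl⟩ := rigid_coordinates hR hAalg (by rw [← hval, hs0])
  have hBE : B = E := by rw [hB]; simp
  -- SPLIT the carrier by rule 1b into `[σ, A]` and `[σ, D(P)/√f]`, both relations
  obtain ⟨sA, hsA, hsAi⟩ := stub_sigmaRep q₂ q₃ hΔ A 0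
  obtain ⟨t, ht, hti⟩ := stub_sigmaRep q₂ q₃ hΔ 0 E
  have hsplit : KZ.of s - KZ.of sA - KZ.of t ∈ KZ.relations := by
    refine integrandAddRel_subset_relations ⟨1, s, sA, t, hsA.trans hs.symm, ht.trans hs.symm,
      fun p hp => ?_, rfl⟩
    rw [hs] at hp
    rw [hsi hp, Pi.add_apply, hsAi, hti, hBE]
    simp
  have hsA0 : KZ.of sA ∈ KZ.relations :=
    hA0 hIA sA hsA fun p _ => by rw [hsAi]; simp
  have ht0 : KZ.of t ∈ KZ.relations := by
    refine stub_hermiteExactForm q₂ q₃ hΔ P t ht fun p _ => ?_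
    rw [hti]
    simp only [map_zero, zero_add, hE, map_add, map_mul, Polynomial.aeval_C, eq_ratCast, map_sub,
      map_pow, Polynomial.aeval_X, map_ofNat, cubic]
    push_cast
    ring
  have hs_rel : KZ.of s ∈ KZ.relations := by
    have : KZ.of s = (KZ.of s - KZ.of sA - KZ.of t) + KZ.of sA + KZ.of t := by abel
    rw [this]
    exact relations.add_mem (relations.add_mem hsplit hsA0) ht0
  have : c = (c - KZ.of s) + KZ.of s := by abel
  rw [this]
  exact relations.add_mem hcs hs_rel

end Summit.KontsevichZagierPeriods.HermiteRigidity.EllipticMomentKernel
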